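import Summits.KontsevichZagierPeriods.Zeta5Search.SymmetricPhatDescent
import Summits.KontsevichZagierPeriods.Zeta5Search.XSaveConjectures
import HarnessLib

/-!
# The `P̂`-side denominator theorem of the descent (22) on Brown–Zudilin's residue-range box (cell `pub-zeta5`, seat ct-1 g46)

HONEST FRAMING: systematic search; no irrationality claim unless certified.  INTEGRALITY bookkeeping of the dictionary
`ζ(3)`-numerator `P̂(a) = ρ(a)(U(b)V(b′) − U(b′)V(b))` (`XSave.PhatOf a j`; under the cell's dictionary the `ζ(3)`-companion of
Brown–Zudilin's cellular integral `I(a)`, arXiv:2210.03391 (4)); nothing here concerns the arithmetic nature of `ζ(5)`/`ζ(3)`;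
no `γ` / record statement; the `P`-side (28)/(30) is NOT touched; records in print UNMOVED; net named-fact debt 0.  Theorems only.

OUR work (Summit side), the general form of `SymmetricPhatDescent` / `SymmetricPhatDenominators` (there: the diagonal).  For EVERY
`a` in the box of the tree's unconditional descent `VWPOfPosConsequences.rhs22_eq_on_box` (partner `j`):
`Σ_{κ=p₄}^{p₄+q₄} w_κ(p;q)·J₃(p₀,p₁,p₂,p₃−κ; q₁,q₂,q₃−p₆+κ) = 2Q(a)ζ(3) − 2P̂(a)` with INTEGER weights `w_κ` (`w22`), and each
companion integral is Rhin–Viola's (`DescentJ3RhinViola.J3_eq_rhinViolaI`)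
`I(p₁, p₃−κ, p₂, q₁, p₂+q₃−p₆+κ−p₀, q₃−p₆+κ, p₁+q₃−p₆+κ−p₀, q₂)`, automatically balanced (`companion_balanced`:
`p₃+q₃−p₆ = q₁+q₂` identically in `a`), with integers (2.8)
`(p₁+q₁−p₃+κ, p₃+q₃−p₀−p₆, p₂−q₁+q₃−p₆+κ, q₁+p₁−p₂, p₂+q₂−p₀, p₀, p₁+p₃+q₃−p₀−p₆−q₂, q₂+p₂−p₁)` (`companion_S`).

* `rhs22_eq_PhatOf` — the descent with its right-hand side named: `rhs22(p;q) = 2Q(a)ζ(3) − 2·PhatOf a j`;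
* **`two_mul_PhatOf_isInt`** — if `D ∈ ℕ` is such that every companion `κ` with `w_κ ≠ 0` has non-negative Rhin–Viola parameters and a
  dominating triple `(M,N,Q)` (counting form `RhinViola2001.Theorem21.Dom`) with `d_M·d_N·d_Q ∣ D·w_κ`, then **`2·D·P̂(a) ∈ ℤ`**
  (Rhin–Viola's Theorem 2.1 `theorem21_of_dom` per term + Apéry, `SymmetricPhatDescent.rat_part_unique`).
Instances: the diagonal (`SymmetricPhatDenominators`, `D = d_n²d_{2n}`) and the record ray (`RecordRayPhatDenominators`).
-/

noncomputable section

open Finset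

namespace Summit.KontsevichZagierPeriods.Zeta5Search.DescentPhatDenominatorsBox

open Literature.NumberTheory.Irrationality
open Literature.NumberTheory.Irrationality.BrownZudilin2022 (J3 w22 rhs22 pOf qOf QOf bOfA Converges)
open Literature.NumberTheory.Irrationality.RhinViola2001 (Params I d)
open Literature.NumberTheory.Irrationality.RhinViola2001.Theorem21 (Dom theorem21_of_dom)
open Literature.NumberTheory.Transcendental (zetaValue)
open Summit.KontsevichZagierPeriods.Zeta5Search.WedgeDictionary (rhoOf coeffU coeffV dOf)
open Summit.KontsevichZagierPeriods.Zeta5Search.XSave (PhatOf)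
open Summit.KontsevichZagierPeriods.Zeta5Search.DescentJ3RhinViola (J3_eq_rhinViolaI balanced_iff)
open Summit.KontsevichZagierPeriods.Zeta5Search.SymmetricPhatDescent (rat_part_unique)

/-! ### The companions of (22) as Rhin–Viola integrals -/

/-- The `κ`-th companion of (22) is Rhin–Viola's `I(p₁, p₃−κ, p₂, q₁, p₂+q₃−p₆+κ−p₀, q₃−p₆+κ, p₁+q₃−p₆+κ−p₀, q₂)`. -/
theorem companion_eq (p : Fin 7 → ℤ) (q : Fin 5 → ℤ) (κ : ℤ) :
    J3 (p 0) (p 1) (p 2) (p 3 - κ) (q 0) (q 1) (q 2 - p 6 + κ) =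
      I ⟨p 1, p 3 - κ, p 2, q 0, p 2 + (q 2 - p 6 + κ) - p 0, q 2 - p 6 + κ, p 1 + (q 2 - p 6 + κ) - p 0, q 1⟩ :=
  J3_eq_rhinViolaI _ _ _ _ _ _ _

/-- Brown–Zudilin's (24) holds identically for the companions of every `a`: `(p₃−κ) + (q₃−p₆+κ) = q₁ + q₂`
(`p₃ + q₃ − p₆ = a₄ + a₃ = q₁ + q₂`), so the Rhin–Viola parameters are balanced. -/
theorem companion_balanced (a : Fin 8 → ℤ) (κ : ℤ) :
    (⟨pOf a 1, pOf a 3 - κ, pOf a 2, qOf a 0, pOf a 2 + (qOf a 2 - pOf a 6 + κ) - pOf a 0, qOf a 2 - pOf a 6 + κ,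
        pOf a 1 + (qOf a 2 - pOf a 6 + κ) - pOf a 0, qOf a 1⟩ : Params).Balanced := by
  rw [balanced_iff]
  simp [pOf, qOf]
  ring

/-- The integers (2.8) of the `κ`-th companion:
`(p₁+q₁−p₃+κ, p₃+q₃−p₀−p₆, p₂−q₁+q₃−p₆+κ, q₁+p₁−p₂, p₂+q₂−p₀, p₀, p₁+p₃+q₃−p₀−p₆−q₂, q₂+p₂−p₁)`. -/
theorem companion_S (p : Fin 7 → ℤ) (q : Fin 5 → ℤ) (κ : ℤ) :
    (⟨p 1, p 3 - κ, p 2, q 0, p 2 + (q 2 - p 6 + κ) - p 0, q 2 - p 6 + κ, p 1 + (q 2 - p 6 + κ) - p 0, q 1⟩ : Params).S =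
      [p 1 + q 0 - p 3 + κ, p 3 + q 2 - p 0 - p 6, p 2 - q 0 + q 2 - p 6 + κ, q 0 + p 1 - p 2, p 2 + q 1 - p 0, p 0,
        p 1 + p 3 + q 2 - p 0 - p 6 - q 1, q 1 + p 2 - p 1] := by
  simp only [Params.S, Params.aux, Params.toList]
  refine List.cons_eq_cons.2 ⟨by ring, List.cons_eq_cons.2 ⟨by ring, List.cons_eq_cons.2 ⟨by ring,
    List.cons_eq_cons.2 ⟨by ring, List.cons_eq_cons.2 ⟨by ring, List.cons_eq_cons.2 ⟨by ring,
    List.cons_eq_cons.2 ⟨by ring, List.cons_eq_cons.2 ⟨by ring, rfl⟩⟩⟩⟩⟩⟩⟩⟩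

/-! ### The descent with its right-hand side named -/

/-- **(22) on the box**: `rhs22(p;q) = 2Q(a)ζ(3) − 2·P̂(a)` with `P̂(a) = XSave.PhatOf a j` — the tree's `rhs22_eq_on_box` read back. -/
theorem rhs22_eq_PhatOf (a : Fin 8 → ℤ) (j : ℕ) (hj : j ∈ Icc 1 7) (hconv : Converges a)
    (hreg : ∀ i ∈ Icc 1 7, 0 ≤ bOfA a i ∧ 2 * bOfA a i ≤ bOfA a 0 + 1) (hd : 0 ≤ dOf (bOfA a))
    (hpart : 2 * (bOfA a j + 1) ≤ bOfA a 0 + 1) (h2b : ∀ i ∈ Icc 1 7, 2 * bOfA a i ≤ bOfA a 0)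
    (hp : ∀ i, 0 ≤ pOf a i) (hres : pOf a 4 + qOf a 3 ≤ pOf a 3)
    (hcl2 : bOfA a 0 - bOfA a 1 - bOfA a 2 ≤ dOf (bOfA a) + max 0 (max (bOfA a 7 - bOfA a 1) (bOfA a 7 - bOfA a 2))) :
    rhs22 (pOf a) (qOf a) = 2 * ((QOf a : ℚ) : ℝ) * zetaValue 3 - 2 * ((PhatOf a j : ℚ) : ℝ) :=
  VWPOfPosConsequences.rhs22_eq_on_box a j hj hconv hreg hd hpart h2b hp hres hcl2

/-! ### The denominator theorem -/

/-- **The `P̂`-side denominator theorem of the descent.**  Let `a` lie in the box of `rhs22_eq_on_box` (partner `j`) and let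
`D ∈ ℕ` be such that every companion `κ ∈ [p₄, p₄+q₄]` with non-zero weight `w_κ` has non-negative Rhin–Viola parameters and a
dominating triple `(M, N, Q)` of its integers (2.8) (no entry exceeds `M`, at most one exceeds `N`, at most two exceed `Q`) with
`d_M·d_N·d_Q ∣ D·w_κ`.  Then `2·D·P̂(a) ∈ ℤ`. -/
theorem two_mul_PhatOf_isInt (a : Fin 8 → ℤ) (j : ℕ) (hj : j ∈ Icc 1 7) (hconv : Converges a)
    (hreg : ∀ i ∈ Icc 1 7, 0 ≤ bOfA a i ∧ 2 * bOfA a i ≤ bOfA a 0 + 1) (hd : 0 ≤ dOf (bOfA a))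
    (hpart : 2 * (bOfA a j + 1) ≤ bOfA a 0 + 1) (h2b : ∀ i ∈ Icc 1 7, 2 * bOfA a i ≤ bOfA a 0)
    (hp : ∀ i, 0 ≤ pOf a i) (hres : pOf a 4 + qOf a 3 ≤ pOf a 3)
    (hcl2 : bOfA a 0 - bOfA a 1 - bOfA a 2 ≤ dOf (bOfA a) + max 0 (max (bOfA a 7 - bOfA a 1) (bOfA a 7 - bOfA a 2)))
    (D : ℕ)
    (hD : ∀ κ ∈ Icc (pOf a 4) (pOf a 4 + qOf a 3), w22 (pOf a) (qOf a) κ ≠ 0 → ∃ M N Q : ℤ,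
      (⟨pOf a 1, pOf a 3 - κ, pOf a 2, qOf a 0, pOf a 2 + (qOf a 2 - pOf a 6 + κ) - pOf a 0, qOf a 2 - pOf a 6 + κ,
          pOf a 1 + (qOf a 2 - pOf a 6 + κ) - pOf a 0, qOf a 1⟩ : Params).Nonneg ∧
      Dom (⟨pOf a 1, pOf a 3 - κ, pOf a 2, qOf a 0, pOf a 2 + (qOf a 2 - pOf a 6 + κ) - pOf a 0, qOf a 2 - pOf a 6 + κ,
          pOf a 1 + (qOf a 2 - pOf a 6 + κ) - pOf a 0, qOf a 1⟩ : Params).S M N Q ∧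
      ((d M * d N * d Q : ℕ) : ℤ) ∣ (D : ℤ) * w22 (pOf a) (qOf a) κ) :
    ∃ z : ℤ, (z : ℚ) = 2 * (D : ℚ) * PhatOf a j := by
  set p := pOf a with hpdef
  set q := qOf a with hqdef
  -- term by term: the Rhin–Viola split (trivial when the weight vanishes), with `D·w_κ·a_κ ∈ ℤ`
  have hsplit : ∀ κ : ℤ, ∃ (x : ℚ) (y : ℤ), (κ ∈ Icc (p 4) (p 4 + q 3) →
      (w22 p q κ : ℝ) * J3 (p 0) (p 1) (p 2) (p 3 - κ) (q 0) (q 1) (q 2 - p 6 + κ) =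
        ((w22 p q κ * x : ℚ) : ℝ) + ((2 * (w22 p q κ * y) : ℚ) : ℝ) * zetaValue 3 ∧
      ∃ A : ℤ, (D : ℚ) * (w22 p q κ * x) = A) := by
    intro κ
    by_cases hκ : κ ∈ Icc (p 4) (p 4 + q 3)
    · by_cases hw : w22 p q κ = 0
      · exact ⟨0, 0, fun _ => ⟨by rw [hw]; push_cast; ring, ⟨0, by rw [hw]; push_cast; ring⟩⟩⟩
      · obtain ⟨M, N, Q, hN, hDom, hdvd⟩ := hD κ hκ hw
        obtain ⟨x, y, hI, A, hA⟩ := theorem21_of_dom _ hN (companion_balanced a κ) hDom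
        obtain ⟨m, hm⟩ := hdvd
        refine ⟨x, y, fun _ => ⟨?_, ⟨m * A, ?_⟩⟩⟩
        · rw [companion_eq, hI]; push_cast; ring
        · have hm' : ((D : ℤ) * w22 p q κ : ℚ) = ((d M * d N * d Q : ℕ) : ℚ) * (m : ℚ) := by exact_mod_cast hm
          push_cast at hm' ⊢
          rw [← hA]
          push_cast
          linear_combination (x : ℚ) * hm'
    · exact ⟨0, 0, fun h => (hκ h).elim⟩
  choose x y hxy using hsplit
  -- the two evaluations of `rhs22`
  have hsum : rhs22 p q = ((∑ κ ∈ Icc (p 4) (p 4 + q 3), w22 p q κ * x κ : ℚ) : ℝ) +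
      ((2 * ∑ κ ∈ Icc (p 4) (p 4 + q 3), w22 p q κ * y κ : ℚ) : ℝ) * zetaValue 3 := by
    unfold rhs22
    push_cast
    simp only [mul_sum, sum_mul, ← sum_add_distrib]
    refine sum_congr rfl fun κ hκ => ?_
    rw [(hxy κ hκ).1]
    push_cast
    ring
  have hclosed := rhs22_eq_PhatOf a j hj hconv hreg hd hpart h2b hp hres hcl2
  rw [hsum] at hclosed
  have key := rat_part_unique (x := ∑ κ ∈ Icc (p 4) (p 4 + q 3), w22 p q κ * x κ)
    (y := 2 * ∑ κ ∈ Icc (p 4) (p 4 + q 3), w22 p q κ * y κ)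
    (x' := -(2 * PhatOf a j)) (y' := 2 * (QOf a : ℚ)) (by rw [hclosed]; push_cast; ring)
  -- assemble
  choose A hA using fun κ (hκ : κ ∈ Icc (p 4) (p 4 + q 3)) => (hxy κ hκ).2
  refine ⟨-((Icc (p 4) (p 4 + q 3)).attach.sum fun κ : {κ : ℤ // κ ∈ Icc (p 4) (p 4 + q 3)} => A κ.1 κ.2), ?_⟩
  have h2 : 2 * (D : ℚ) * PhatOf a j = -((D : ℚ) * ∑ κ ∈ Icc (p 4) (p 4 + q 3), w22 p q κ * x κ) := by
    rw [key]; ring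
  have hS : ∑ κ ∈ Icc (p 4) (p 4 + q 3), (D : ℚ) * (w22 p q κ * x κ) =
      (Icc (p 4) (p 4 + q 3)).attach.sum fun κ : {κ : ℤ // κ ∈ Icc (p 4) (p 4 + q 3)} => (A κ.1 κ.2 : ℚ) := by
    rw [← sum_attach]
    exact sum_congr rfl fun κ _ => hA κ.1 κ.2
  rw [h2, mul_sum, hS]
  push_cast
  ring

end Summit.KontsevichZagierPeriods.Zeta5Search.DescentPhatDenominatorsBox
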